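import Literature.AlgebraicGeometry.Motives.TannakianDeligneTorusMumfordTateTensorProduct
import HarnessLib

/-!
# MOONEN 1999 (1.8) for `T^{1,1} = V ⊗ V^*`: `MT(V ⊗ V^∨)` (and `Hg`) is the image of `MT(V)` under
# `Ad : GL(V) → GL(V ⊗ V^∨)`, `g ↦ g ⊗ (gᵗ)⁻¹`, at scheme level

[topic AlgebraicGeometry/Motives]

Layer `Literature/AlgebraicGeometry/Motives`, lane `lit-hodgefound` (Track 2 foundations library — Layer A3 «Mumford–Tate
group»; prover seat `lit-hodgefound-p26`, gen 50, row g50-#7). Sequel of g50-#6 `…MumfordTateTensorProduct`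
(`hodgeHomRat_tensor : h_{H ⊗ H′}^* = (h_H^*, h_{H′}^*) ∘ kron`, any two weights), g49-#9 `…MumfordTateDual` (`hodgeHomRat_dual
: h_{H^∨}^* = h_H^* ∘ invTranspose`), g49-#8 `…GeneralLinearGroupInverseTranspose` (`GLn.invTranspose`, `invTransposeBialgHom`,
`pointMatrix_comp_invTranspose`), g50-#5 `…GeneralLinearGroupKronecker` (`kron`, `kronBialgHom`) and g50-#1
`…GeneratedSubgroupImage` (GGK (I.B.3) `mumfordTateIdeal_eq_comap_of_hodgeHomRat_eq` ∕ `hodgeGroupIdeal_eq_comap_of_hodgeHomRat_eq`).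
DEFINITIONS with bodies (`GLn.tensorInvTranspose`, `GLn.tensorInvTransposeBialgHom`: the homomorphism `Ad : GL_ι → GL_{ι ×
ι}`, `g ↦ g ⊗ (gᵗ)⁻¹`, i.e. the representation `T^{1,1} = V ⊗ V^* ≅ End(V)` of `GL(V)` in the basis `b ⊗ b^∨`) + THEOREMS;
no named fact (net debt `0`), no `instance`, no notation (Mathlib's scoped `⊗ₖ`, `ᵀ` opened), no sorry; the tree's
discharged class `HodgeTensorFacts` is installed with `haveI := hodgeTensorFacts_holds`, never assumed.

## The sources, verbatim

B. Moonen, *Notes on Mumford–Tate groups* (CEB, 1999) [Moonen1999MTNotes] (`paper:url-c4d52097ebb3`), p. 3 (1.5): "Let `V`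
be a `ℚ`-HS. For `m, n ∈ ℤ_{≥0}`, write `T^{m,n} := V^{⊗m} ⊗ (V^*)^{⊗n}`."; p. 4 (1.8): "Remark. Let `T` be a tensor
construction as in (1.5). Write `r: GL(V) → GL(T)` for the canonical homomorphism. Then `MT(T)` equals the image of
`MT(V)` under `r`. To see this, let us first remark that `MT(T)` is contained in the image of `MT(V)`; this is immediate
from the definitions. […] As examples of this principle, we find that `MT(V^*)` is isomorphic to `MT(V)` (under the
natural isomorphism `g ↦ (g^*)^{−1}`)."

B. Moonen, *An introduction to Mumford–Tate groups* (2004) [Moonen2004MT] (`paper:url-8e52397fca11`), §3 p. 7: "The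
representation `h: GL(V ⊗ W)_ℝ` corresponding to the Hodge structure `V ⊗ W` is of course just the tensor product of the
representation `h_V` and `h_W`; similarly for the operations `Hom( , )`, `( )^∨`, `Sym^k( )` and `∧^k`."; (4.3) p. 8: "`T^ν
:= ⊕ V^{⊗a_i} ⊗ (V^∨)^{⊗b_i}`, which inherits a natural Hodge structure from `V`. The groups `MT(V) ⊆ GL(V)` naturally act
on `T^ν`."

M. Green, P. Griffiths, M. Kerr, *Mumford–Tate groups and domains* (2012) [GreenGriffithsKerr2012] (held text p0039),
(I.B.3): "`M_{ρ(φ̃)}` is the image of `M_φ̃` under the natural map `ρ : GL(V) → GL(V_ρ)`."; §I.B (I.B.1) the tensor spaces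
`T^{k,l} = V^{⊗k} ⊗ V̌^{⊗l}`; §III.A: "`M_{ρ(φ)} = ρ(M_φ)` for any representation `ρ`".

J. S. Milne, *Algebraic Groups* (2017) [Milne2017]: 2.8 (chunk p0125), 3.4–3.5, Ch. 22 §c («`r^∨(g)v^∨ = (r(g)^∨)^{−1}
v^∨`»), Cor. 1.69, Summary 1.71.

READING (recorded — RULING 29; `GL(V) = GL_{ι,ℚ}` through `b`, `GL(V^∨)` through the dual basis `b^∨`, `GL(V ⊗ V^∨) = GL_{ι ×
ι}` through `b ⊗ b^∨`). §0 the canonical homomorphism `r = Ad : GL(V) → GL(T^{1,1})`, `g ↦ g ⊗ (gᵗ)⁻¹` of MOONEN (1.8) ∕ GGK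
(I.B.3), is the algebra map **`GLn.tensorInvTranspose = mul ∘ (id ⊗ invTranspose) ∘ kron`**, `T_{(i,k)(j,l)} ↦ T_ij · (T⁻¹)_lk`,
with **`pointMatrix_comp_tensorInvTranspose : [g ∘ Ad^*] = [g] ⊗ₖ ([g]⁻¹)ᵀ`** on points, and a bialgebra map
**`tensorInvTransposeBialgHom`** (composite of Mathlib's `mulBialgHom`, `Bialgebra.TensorProduct.map id invTransposeBialgHom`
and `kronBialgHom`). §1 by g50-#6 `hodgeHomRat_tensor` and g49-#9 `hodgeHomRat_dual`: **`hodgeHomRat_tensor_dual : h_{H ⊗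
H^∨}^* = h_H^* ∘ Ad^*`**. §2 g50-#1's (I.B.3): **`mumfordTateIdeal_tensor_dual : I_{MT(H ⊗ H^∨)} = (Ad^*)⁻¹(I_{MT(H)})`** — `MT(V
⊗ V^*)` is the scheme-theoretic image `Ad(MT(V))`, «`MT(T)` equals the image of `MT(V)` under `r`» for `T = T^{1,1}` —
with **`quotientMapₐ_tensorInvTranspose_injective`** (dominance; surjectivity by MILNE 1.69 ∕ 1.71) and on `T`-points
`comp_tensorInvTranspose_mem_mumfordTatePoints` (`g ∈ MT(H)(T) ⟹ [g] ⊗ₖ ([g]ᵗ)⁻¹ ∈ MT(H ⊗ H^∨)(T)`). §3 the same for the Hodge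
group (GGK §III.A). What is NOT here: the identification `V ⊗ V^∨ ≅ End(V)` as Hodge structures (the tree's internal
`Hom`), the equality of POINT groups, and MOONEN (1.8)'s Key-Property half.

## Contents

* §0 (namespace `…Tannakian.GLn`) **`tensorInvTranspose`**, `tensorInvTranspose_T`, **`pointMatrix_comp_tensorInvTranspose`**,
  **`tensorInvTransposeBialgHom`**, `coe_tensorInvTransposeBialgHom`, `tensorInvTransposeBialgHom_apply`.
* §1 (namespace `…Tannakian.DeligneTorus`) **`hodgeHomRat_tensor_dual`**, `hodgeHomRat_tensor_dual_eq_comp_tensorInvTransposeBialgHom`.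
* §2 **`mumfordTateIdeal_tensor_dual`**, `mumfordTateIdeal_tensor_dual_le_comap`, **`quotientMapₐ_tensorInvTranspose_injective`**,
  `comp_tensorInvTranspose_mem_mumfordTatePoints`.
* §3 **`hodgeGroupIdeal_tensor_dual`**, `comp_tensorInvTranspose_mem_hodgeGroupPoints`.

## References

* [Moonen1999MTNotes] B. Moonen, *Notes on Mumford–Tate groups*, CEB Rennes (1999): (1.5) p. 3, (1.8) p. 4.
* [Moonen2004MT] B. Moonen, *An introduction to Mumford–Tate groups* (2004): §3 p. 7, (4.3) p. 8.
* [GreenGriffithsKerr2012] M. Green, P. Griffiths, M. Kerr, *Mumford–Tate groups and domains*, Annals of Math. Studies 183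
  (2012): §I.B (I.B.1), (I.B.3) (chunk p0039); §III.A.
* [Milne2017] J. S. Milne, *Algebraic Groups*, CUP (2017): 2.8, 2.30, 3.4–3.5, Ch. 22 §c, Cor. 1.69, Summary 1.71.
-/

noncomputable section

namespace Literature.AlgebraicGeometry.Motives.Tannakian

open TensorProduct WithConv Coalgebra
open scoped Kronecker Matrix

universe u v w

/-! ## §0 The homomorphism `Ad : GL_ι → GL_{ι × ι}`, `g ↦ g ⊗ (gᵗ)⁻¹` (the representation `T^{1,1} = V ⊗ V^∨ ≅ End V` of
`GL(V)`) on coordinate rings -/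

namespace GLn

section TensorInvTranspose

variable (R : Type u) [CommRing R] (ι : Type v) [Fintype ι] [DecidableEq ι]

/-- **The comorphism `O(GL_{ι × ι}) → O(GL_ι)` of `g ↦ g ⊗ (gᵗ)⁻¹`** (the representation `T^{1,1} = V ⊗ V^*` of `GL(V)` in
the basis `b ⊗ b^∨`): `kron` (g50-#5), then `id ⊗ invTranspose` (g49-#8, the contragredient `g ↦ (gᵗ)⁻¹`), then
multiplication; `T_{(i,k)(j,l)} ↦ T_ij · (T⁻¹)_lk`. [cite: Moonen1999MTNotes, (1.5) («T^{m,n} := V^{⊗m} ⊗ (V^*)^{⊗n}»), (1.8)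
(«Write r : GL(V) → GL(T) for the canonical homomorphism»); GreenGriffithsKerr2012, §I.B (I.B.1), (I.B.3); Milne2017, 2.8,
Ch. 22 §c («r^∨(g)v^∨ = (r(g)^∨)^{−1} v^∨»)] -/
def tensorInvTranspose : Coord R (ι × ι) →ₐ[R] Coord R ι :=
  (Algebra.TensorProduct.lmul' R).comp
    ((Algebra.TensorProduct.map (AlgHom.id R (Coord R ι)) invTranspose).comp (kron R ι ι))

/-- `tensorInvTranspose T_{(i,k)(j,l)} = T_ij · (T⁻¹)_lk`. [cite: Moonen1999MTNotes, (1.8); Milne2017, 2.8, 3.5] -/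
@[simp] theorem tensorInvTranspose_T (i k j l : ι) :
    tensorInvTranspose R ι (T R (ι × ι) (i, k) (j, l)) = T R ι i j * invMat R ι l k := by
  rw [tensorInvTranspose, AlgHom.comp_apply, AlgHom.comp_apply, kron_T, Algebra.TensorProduct.map_tmul, AlgHom.id_apply,
    invTranspose_T, Algebra.TensorProduct.lmul'_apply_tmul]

variable {R ι}
variable {B : Type w} [CommRing B] [Algebra R B]

/-- **On points: `g ∘ Ad^* = [g] ⊗ₖ ([g]⁻¹)ᵀ`** — the `B`-point `g` of `GL_ι` goes to `[g] ⊗ₖ ([g]ᵗ)⁻¹ ∈ GL_{ι × ι}(B)`.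
[cite: Moonen1999MTNotes, (1.8); GreenGriffithsKerr2012, §I.B (I.B.3); Milne2017, Ch. 22 §c, 2.8] -/
theorem pointMatrix_comp_tensorInvTranspose (g : Coord R ι →ₐ[R] B) :
    pointMatrix (g.comp (tensorInvTranspose R ι)) = pointMatrix g ⊗ₖ ((pointMatrix g)⁻¹)ᵀ := by
  rw [← pointMatrix_comp_invTranspose]
  ext ⟨i, k⟩ ⟨j, l⟩
  rw [pointMatrix_apply, AlgHom.comp_apply, tensorInvTranspose_T, map_mul, Matrix.kroneckerMap_apply, pointMatrix_apply,
    pointMatrix_apply, AlgHom.comp_apply, invTranspose_T]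

variable (R ι)

/-- **`Ad : GL_ι → GL_{ι × ι}` is a homomorphism**: `tensorInvTranspose` as a bialgebra map — `mulBialgHom ∘ (id ⊗
invTransposeBialgHom) ∘ kronBialgHom` (Mathlib's `Bialgebra.TensorProduct.map`, `mulBialgHom`; g49-#8
`invTransposeBialgHom`; g50-#5 `kronBialgHom`). A definition with body; no instance. [cite: Moonen1999MTNotes, (1.8);
Milne2017, 3.4, 2.30, Ch. 22 §c] -/
def tensorInvTransposeBialgHom :
    letI := bialgebra R ι; letI := bialgebra R (ι × ι); Coord R (ι × ι) →ₐc[R] Coord R ι :=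
  letI := bialgebra R ι
  letI := bialgebra R (ι × ι)
  (Bialgebra.mulBialgHom R (Coord R ι)).comp
    ((Bialgebra.TensorProduct.map (BialgHom.id R (Coord R ι)) (invTransposeBialgHom (R := R) (ι := ι))).comp
      (kronBialgHom R ι ι))

/-- The algebra map underlying `tensorInvTransposeBialgHom` is `tensorInvTranspose`. [cite: Milne2017, 2.8] -/
theorem coe_tensorInvTransposeBialgHom :
    letI := bialgebra R ι; letI := bialgebra R (ι × ι)
    (tensorInvTransposeBialgHom R ι : Coord R (ι × ι) →ₐ[R] Coord R ι) = tensorInvTranspose R ι := by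
  letI := bialgebra R ι
  letI := bialgebra R (ι × ι)
  refine algHom_ext fun p q => ?_
  obtain ⟨i, k⟩ := p
  obtain ⟨j, l⟩ := q
  rw [BialgHom.coe_toAlgHom, tensorInvTranspose_T]
  change Bialgebra.mulBialgHom R (Coord R ι)
      (Bialgebra.TensorProduct.map (BialgHom.id R (Coord R ι)) (invTransposeBialgHom (R := R) (ι := ι))
        (kronBialgHom R ι ι _)) = _
  rw [kronBialgHom_apply, kron_T, Bialgebra.TensorProduct.map_tmul, BialgHom.id_apply, invTransposeBialgHom_apply,
    invTranspose_T, Bialgebra.coe_mulBialgHom, LinearMap.mul'_apply]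

/-- `tensorInvTransposeBialgHom x = tensorInvTranspose x`. [cite: Milne2017, 2.8] -/
theorem tensorInvTransposeBialgHom_apply (x : Coord R (ι × ι)) :
    letI := bialgebra R ι; letI := bialgebra R (ι × ι); tensorInvTransposeBialgHom R ι x = tensorInvTranspose R ι x := by
  letI := bialgebra R ι
  letI := bialgebra R (ι × ι)
  exact AlgHom.congr_fun (coe_tensorInvTransposeBialgHom R ι) x

end TensorInvTranspose

end GLn

namespace DeligneTorus

open HodgeStructure

variable {V : Type u} [AddCommGroup V] [Module ℚ V] [Module.Finite ℚ V] {n : ℤ} {ι : Type v} [Fintype ι] [DecidableEq ι]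

/-! ## §1 `h_{H ⊗ H^∨} = Ad ∘ h_H` -/

/-- **`h_{H ⊗ H^∨}^* = h_H^* ∘ Ad^*`**: the homomorphism `𝕊_ℂ → GL(V ⊗ V^∨)` of `H ⊗ H^∨` (basis `b ⊗ b^∨`) is `h_H` followed
by `Ad : GL(V) → GL(V ⊗ V^∨)`, `g ↦ g ⊗ (gᵗ)⁻¹` (g50-#6 `hodgeHomRat_tensor` + g49-#9 `hodgeHomRat_dual`). [cite:
Moonen1999MTNotes, (1.5), (1.8); GreenGriffithsKerr2012, §I.B (I.B.1) («T^{k,l} = V^{⊗k} ⊗ V̌^{⊗l}»), (I.B.3) («(V_ρ, ρ ∘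
φ̃)»); Moonen2004MT, §3 («similarly for the operations Hom( , ), ( )^∨»)] -/
theorem hodgeHomRat_tensor_dual (H : HodgeStructure V n) (b : Module.Basis ι ℚ V) :
    haveI := hodgeTensorFacts_holds.{u, u}
    hodgeHomRat (H.tensor H.dual) (b.tensorProduct b.dualBasis) = (hodgeHomRat H b).comp (GLn.tensorInvTranspose ℚ ι) := by
  refine GLn.algHom_ext fun p q => ?_
  obtain ⟨i, k⟩ := p
  obtain ⟨j, l⟩ := q
  rw [hodgeHomRat_tensor, AlgHom.comp_apply, AlgHom.comp_apply, GLn.kron_T, GLn.tensorInvTranspose_T,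
    Algebra.TensorProduct.productMap_apply_tmul, map_mul, hodgeHomRat_dual_apply, GLn.invTranspose_T]

/-- The same with the bialgebra map `tensorInvTransposeBialgHom` (the hypothesis of g50-#1's (I.B.3)). [cite:
Moonen1999MTNotes, (1.8); GreenGriffithsKerr2012, §I.B (I.B.3)] -/
theorem hodgeHomRat_tensor_dual_eq_comp_tensorInvTransposeBialgHom (H : HodgeStructure V n) (b : Module.Basis ι ℚ V) :
    haveI := hodgeTensorFacts_holds.{u, u}; letI := GLn.bialgebra ℚ ι; letI := GLn.bialgebra ℚ (ι × ι)
    hodgeHomRat (H.tensor H.dual) (b.tensorProduct b.dualBasis) =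
      (hodgeHomRat H b).comp (GLn.tensorInvTransposeBialgHom ℚ ι : GLn.Coord ℚ (ι × ι) →ₐ[ℚ] GLn.Coord ℚ ι) := by
  rw [GLn.coe_tensorInvTransposeBialgHom, hodgeHomRat_tensor_dual]

/-! ## §2 MOONEN 1999 (1.8) for `T = T^{1,1} = V ⊗ V^*`: `MT(H ⊗ H^∨) = Ad(MT(H))` -/

/-- **MOONEN 1999 (1.8) for `T^{1,1} = V ⊗ V^* (≅ End V)`: `MT(V ⊗ V^*)` is the image of `MT(V)` under `Ad : g ↦ g ⊗
(gᵗ)⁻¹`, AT SCHEME LEVEL** — the Mumford–Tate ideal of `H ⊗ H^∨` (basis `b ⊗ b^∨`) is the preimage of that of `H` under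
`tensorInvTranspose` (g50-#1's GGK (I.B.3) with `ρ = Ad`). [cite: Moonen1999MTNotes, (1.8) («MT(T) equals the image of MT(V)
under r»); GreenGriffithsKerr2012, §I.B (I.B.3), (I.B.1); Moonen2004MT, (4.3) («The groups MT(V) ⊆ GL(V) naturally act on
T^ν»)] -/
theorem mumfordTateIdeal_tensor_dual (H : HodgeStructure V n) (b : Module.Basis ι ℚ V) :
    haveI := hodgeTensorFacts_holds.{u, u}
    mumfordTateIdeal (H.tensor H.dual) (b.tensorProduct b.dualBasis) =
      (mumfordTateIdeal H b).comap (GLn.tensorInvTranspose ℚ ι) := by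
  haveI := hodgeTensorFacts_holds.{u, u}
  letI := GLn.bialgebra ℚ ι
  letI := GLn.bialgebra ℚ (ι × ι)
  have h := mumfordTateIdeal_eq_comap_of_hodgeHomRat_eq H b (H.tensor H.dual) (b.tensorProduct b.dualBasis)
    (GLn.tensorInvTransposeBialgHom ℚ ι) (hodgeHomRat_tensor_dual_eq_comp_tensorInvTransposeBialgHom H b)
  rw [h]
  exact Ideal.ext fun x => by rw [Ideal.mem_comap, Ideal.mem_comap, GLn.tensorInvTransposeBialgHom_apply]

/-- `I_{MT(H ⊗ H^∨)} ≤ Ad^{*−1}(I_{MT(H)})` along the algebra map. [cite: Moonen1999MTNotes, (1.8) («MT(T) is contained in the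
image of MT(V)»)] -/
theorem mumfordTateIdeal_tensor_dual_le_comap (H : HodgeStructure V n) (b : Module.Basis ι ℚ V) :
    haveI := hodgeTensorFacts_holds.{u, u}
    mumfordTateIdeal (H.tensor H.dual) (b.tensorProduct b.dualBasis) ≤
      (mumfordTateIdeal H b).comap (GLn.tensorInvTranspose ℚ ι) :=
  (mumfordTateIdeal_tensor_dual H b).le

/-- **`Ad : MT(H) → MT(H ⊗ H^∨)` is dominant** (`O(GL_{ι × ι})/I_{MT(H ⊗ H^∨)} → O(GL_ι)/I_{MT(H)}` is injective). [cite: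
Moonen1999MTNotes, (1.8); GreenGriffithsKerr2012, §I.B (I.B.3); Milne2017, Cor. 1.69, Summary 1.71] -/
theorem quotientMapₐ_tensorInvTranspose_injective (H : HodgeStructure V n) (b : Module.Basis ι ℚ V) :
    haveI := hodgeTensorFacts_holds.{u, u}
    Function.Injective (Ideal.quotientMapₐ (mumfordTateIdeal H b) (GLn.tensorInvTranspose ℚ ι)
      (mumfordTateIdeal_tensor_dual_le_comap H b)) := by
  refine (injective_iff_map_eq_zero _).2 fun a ha => ?_
  obtain ⟨a, rfl⟩ := Ideal.Quotient.mk_surjective a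
  rw [Ideal.quotient_map_mkₐ, Ideal.Quotient.mkₐ_eq_mk, Ideal.Quotient.eq_zero_iff_mem] at ha
  rw [Ideal.Quotient.eq_zero_iff_mem, mumfordTateIdeal_tensor_dual H b]
  exact ha

variable {T : Type w} [CommRing T] [Algebra ℚ T]

/-- **On `T`-points: `g ∈ MT(H)(T) ⟹ [g] ⊗ₖ ([g]ᵗ)⁻¹ ∈ MT(H ⊗ H^∨)(T)`** (`§0 pointMatrix_comp_tensorInvTranspose`). [cite:
Moonen1999MTNotes, (1.8); Moonen2004MT, (4.3); GreenGriffithsKerr2012, §I.B (I.B.3)] -/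
theorem comp_tensorInvTranspose_mem_mumfordTatePoints (H : HodgeStructure V n) (b : Module.Basis ι ℚ V)
    {g : WithConv (GLn.Coord ℚ ι →ₐ[ℚ] T)} (hg : letI := GLn.bialgebra ℚ ι; g ∈ mumfordTatePoints H b T) :
    haveI := hodgeTensorFacts_holds.{u, u}; letI := GLn.bialgebra ℚ (ι × ι)
    toConv (g.ofConv.comp (GLn.tensorInvTranspose ℚ ι)) ∈ mumfordTatePoints (H.tensor H.dual) (b.tensorProduct b.dualBasis) T := by
  rw [mem_mumfordTatePoints_iff, WithConv.ofConv_toConv, mumfordTateIdeal_tensor_dual]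
  intro a ha
  exact hg ha

/-! ## §3 The same for the Hodge group -/

/-- **`Hg(H ⊗ H^∨) = Ad(Hg(H))`**: the Hodge-group ideal of `H ⊗ H^∨` is the preimage of that of `H` under
`tensorInvTranspose`. [cite: Moonen1999MTNotes, (1.8); GreenGriffithsKerr2012, §III.A («M_{ρ(φ)} = ρ(M_φ)»)] -/
theorem hodgeGroupIdeal_tensor_dual (H : HodgeStructure V n) (b : Module.Basis ι ℚ V) :
    haveI := hodgeTensorFacts_holds.{u, u}
    hodgeGroupIdeal (H.tensor H.dual) (b.tensorProduct b.dualBasis) =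
      (hodgeGroupIdeal H b).comap (GLn.tensorInvTranspose ℚ ι) := by
  haveI := hodgeTensorFacts_holds.{u, u}
  letI := GLn.bialgebra ℚ ι
  letI := GLn.bialgebra ℚ (ι × ι)
  have h := hodgeGroupIdeal_eq_comap_of_hodgeHomRat_eq H b (H.tensor H.dual) (b.tensorProduct b.dualBasis)
    (GLn.tensorInvTransposeBialgHom ℚ ι) (hodgeHomRat_tensor_dual_eq_comp_tensorInvTransposeBialgHom H b)
  rw [h]
  exact Ideal.ext fun x => by rw [Ideal.mem_comap, Ideal.mem_comap, GLn.tensorInvTransposeBialgHom_apply]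

/-- **`g ∈ Hg(H)(T) ⟹ [g] ⊗ₖ ([g]ᵗ)⁻¹ ∈ Hg(H ⊗ H^∨)(T)`.** [cite: Moonen1999MTNotes, (1.8); GreenGriffithsKerr2012, §III.A] -/
theorem comp_tensorInvTranspose_mem_hodgeGroupPoints (H : HodgeStructure V n) (b : Module.Basis ι ℚ V)
    {g : WithConv (GLn.Coord ℚ ι →ₐ[ℚ] T)} (hg : letI := GLn.bialgebra ℚ ι; g ∈ hodgeGroupPoints H b T) :
    haveI := hodgeTensorFacts_holds.{u, u}; letI := GLn.bialgebra ℚ (ι × ι)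
    toConv (g.ofConv.comp (GLn.tensorInvTranspose ℚ ι)) ∈ hodgeGroupPoints (H.tensor H.dual) (b.tensorProduct b.dualBasis) T := by
  rw [mem_hodgeGroupPoints_iff, WithConv.ofConv_toConv, hodgeGroupIdeal_tensor_dual]
  intro a ha
  exact hg ha

end DeligneTorus

end Literature.AlgebraicGeometry.Motives.Tannakian
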